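import Summits.MatrixMultiplication.MatrixMultiplication.Theorems.SoloBlindConeLift

/-!
# Conjecture H♯: good colourings versus monochromatic members

Sub-programme (K₃).  For `h : ι → G`, `S : Finset ι` and a target `σ`, call a 2-colouring `U ⊆ S` GOOD when
`σ + Σ_{U} h` or `σ + Σ_{S \ U} h` is a sub-sum of `S` (`soloBlindGoodColourings`).  A member `T` of `F(σ)`
(`Σ_T h = σ`) that is monochromatic (`T ⊆ U` or `T ⊆ S \ U`) makes `U` good, and the number of
(colouring, monochromatic member) incidences is `Σ_{T ∈ F(σ)} 2^{|S|+1-|T|} = 2^{|S|+1} · K(σ; S)`.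
CONJECTURE H♯ (`soloBlindHSharp h S σ`): the number of good colourings is at least this incidence count.
Numerically it holds at every H-good target of every zero-sum-free set tested in ranks 3–7 (≈ 7.5·10⁴
targets, adversarial search included), with many equality cases; the inclusion–exclusion defect of two
members `T₁, T₂` is repaired exactly by the `𝔽₃`-affine combination `2·1_{T₁} + 2·1_{T₂}`.
Here we record the definitions and the two formal facts that place H♯ in the programme:
* `soloBlind_good_of_mono` — a monochromatic member makes the colouring good;
* `soloBlind_conjE_of_hsharp` — H♯ at `(S, σ)` implies Conjecture E there: `K(σ; S) ≤ 1/2` (good colourings are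
  at most `2^{|S|}`), hence, through the cone lift `soloBlind_kraft_of_conjE`, H♯ one rank up gives (K₃).
-/

namespace Summit.MatrixMultiplication.MatrixMultiplication.Theorems

open Finset

universe u v

variable {ι : Type v} [DecidableEq ι]
variable {G : Type u} [AddCommGroup G] [DecidableEq G]

/-- The GOOD colourings of `S` for the target `σ`: `U ⊆ S` such that `σ + Σ_U h` or `σ + Σ_{S \ U} h` is a
sub-sum of `S`. -/
def soloBlindGoodColourings (h : ι → G) (S : Finset ι) (σ : G) : Finset (Finset ι) :=
  S.powerset.filter (fun U =>
    (∃ V ∈ S.powerset, ∑ i ∈ V, h i = σ + ∑ i ∈ U, h i) ∨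
      (∃ V ∈ S.powerset, ∑ i ∈ V, h i = σ + ∑ i ∈ S \ U, h i))

/-- CONJECTURE H♯ at `(S, σ)`: `#good colourings ≥ Σ_{T ∈ F(σ)} 2^{|S|+1-|T|}` (the number of pairs
(colouring, monochromatic member)). -/
def soloBlindHSharp (h : ι → G) (S : Finset ι) (σ : G) : Prop :=
  ∑ T ∈ soloBlindSeqRepAll h S σ, (2 : ℚ) ^ (S.card + 1 - T.card) ≤
    ((soloBlindGoodColourings h S σ).card : ℚ)

/-- Membership in the good colourings. -/
theorem soloBlind_mem_goodColourings {h : ι → G} {S : Finset ι} {σ : G} {U : Finset ι} :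
    U ∈ soloBlindGoodColourings h S σ ↔ U ⊆ S ∧
      ((∃ V ⊆ S, ∑ i ∈ V, h i = σ + ∑ i ∈ U, h i) ∨
        (∃ V ⊆ S, ∑ i ∈ V, h i = σ + ∑ i ∈ S \ U, h i)) := by
  simp [soloBlindGoodColourings]

/-- A MONOCHROMATIC MEMBER MAKES THE COLOURING GOOD: if `T ⊆ S` represents `σ` and `T ⊆ U` or `T ⊆ S \ U`
(`U ⊆ S`), then `U` is good. -/
theorem soloBlind_good_of_mono (h : ι → G) {S U T : Finset ι} {σ : G} (hU : U ⊆ S) (hT : T ⊆ S)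
    (hsum : ∑ i ∈ T, h i = σ) (hmono : T ⊆ U ∨ T ⊆ S \ U) :
    U ∈ soloBlindGoodColourings h S σ := by
  rw [soloBlind_mem_goodColourings]
  refine ⟨hU, ?_⟩
  rcases hmono with hTU | hTU
  · -- `T ⊆ U`: `V = (S \ U) ∪ T` has sum `Σ_{S \ U} + σ`
    right
    refine ⟨(S \ U) ∪ T, union_subset sdiff_subset hT, ?_⟩
    have hdisj : Disjoint (S \ U) T := by
      rw [Finset.disjoint_left]
      intro i hi hiT
      exact (mem_sdiff.mp hi).2 (hTU hiT)
    rw [sum_union hdisj, hsum, add_comm]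
  · -- `T ⊆ S \ U`: `V = U ∪ T` has sum `Σ_U + σ`
    left
    refine ⟨U ∪ T, union_subset hU hT, ?_⟩
    have hdisj : Disjoint U T := by
      rw [Finset.disjoint_left]
      intro i hi hiT
      exact (mem_sdiff.mp (hTU hiT)).2 hi
    rw [sum_union hdisj, hsum, add_comm]

omit [DecidableEq ι] in
/-- The incidence count is `2^{|S|+1} K(σ; S)`. -/
theorem soloBlind_incidence_eq_mass (h : ι → G) (S : Finset ι) (σ : G) :
    ∑ T ∈ soloBlindSeqRepAll h S σ, (2 : ℚ) ^ (S.card + 1 - T.card) =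
      2 ^ (S.card + 1) * soloBlindMass h S σ := by
  rw [soloBlindMass, mul_sum]
  refine sum_congr rfl fun T hT => ?_
  have hTS : T ⊆ S := (soloBlind_mem_seqRepAll.mp hT).1
  have hk : T.card ≤ S.card + 1 := (card_le_card hTS).trans (Nat.le_succ _)
  obtain ⟨d, hd⟩ := Nat.exists_eq_add_of_le hk
  have hd' : S.card + 1 - T.card = d := by omega
  have hone : (2 : ℚ) ^ T.card * (1 / 2) ^ T.card = 1 := by
    rw [← mul_pow]; norm_num
  rw [hd', hd, pow_add]
  linear_combination (-(2 : ℚ) ^ d) * hone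

/-- There are at most `2^{|S|}` good colourings. -/
theorem soloBlind_goodColourings_card_le (h : ι → G) (S : Finset ι) (σ : G) :
    ((soloBlindGoodColourings h S σ).card : ℚ) ≤ 2 ^ S.card := by
  have h1 : (soloBlindGoodColourings h S σ).card ≤ S.powerset.card :=
    card_le_card (filter_subset _ _)
  rw [card_powerset] at h1
  exact_mod_cast h1

/-- H♯ IMPLIES CONJECTURE E at the same target: `K(σ; S) ≤ 1/2`. -/
theorem soloBlind_conjE_of_hsharp {h : ι → G} {S : Finset ι} {σ : G} (hH : soloBlindHSharp h S σ) :
    soloBlindMass h S σ ≤ 1 / 2 := by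
  have h1 := soloBlind_incidence_eq_mass h S σ
  have h2 := soloBlind_goodColourings_card_le h S σ
  unfold soloBlindHSharp at hH
  rw [h1, pow_succ] at hH
  have hpos : (0 : ℚ) < 2 ^ S.card := by positivity
  have h3 : 2 ^ S.card * (2 * soloBlindMass h S σ) ≤ 2 ^ S.card * 1 := by
    rw [← mul_assoc, mul_one]
    exact hH.trans h2
  have h4 := le_of_mul_le_mul_left h3 hpos
  linarith

omit [DecidableEq ι] in
/-- H♯ ONE RANK UP GIVES (K₃): if H♯ holds at every H-good target of every zero-sum-free configuration in
exponent-3 groups (in the universes of the cone), then every zero-sum-free `S` satisfies `K(σ; S) ≤ 1` at every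
target. -/
theorem soloBlind_kraft_of_hsharp
    (hH : ∀ {κ : Type v} [DecidableEq κ] {G' : Type u} [AddCommGroup G'] [DecidableEq G'],
      (∀ g : G', g + g + g = 0) → ∀ (h' : κ → G') (S' : Finset κ) (τ' : G'),
      (∀ T ⊆ S', T.Nonempty → ∑ i ∈ T, h' i ≠ 0) → (∀ T ⊆ S', ∑ i ∈ T, h' i ≠ τ' + τ') →
      soloBlindHSharp h' S' τ')
    (three : ∀ g : G, g + g + g = 0) (h : ι → G) (S : Finset ι)
    (zsf : ∀ T ⊆ S, T.Nonempty → ∑ i ∈ T, h i ≠ 0) (σ : G) : soloBlindMass h S σ ≤ 1 :=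
  soloBlind_kraft_of_conjE
    (fun three' h' S' τ' zsf' hgood' => by
      classical
      exact soloBlind_conjE_of_hsharp (hH three' h' S' τ' zsf' hgood'))
    three h S zsf σ

end Summit.MatrixMultiplication.MatrixMultiplication.Theorems
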